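import Mathlib

/-!
# Crux `AclSubsetLogFreeCore` (stmt-Schanuel-0968), line `eac-extends-core-automorphisms`,
`stub_caseII` — the two PERIODICITY lemmas of the log-shift argument (drefute gen 4, evidence for the lead)

In Case II of the residue (A₀) an L-step `s` (a logarithm, `e^s = b`) is shifted by the core
automorphisms `s ↦ s + m j·2πi` (`stub_logShift`), `j ∈ ℤ`; `s` is transcendental over the coefficient
field `F ∋ 2πi`, so a relation that survives all shifts is an identity in the variable `S`, and the
argument (drefute gen 3 §6 / gen 4 `Negative-notes/stub_caseII.md`) reduces to two facts about polynomials
over a field of characteristic zero, recorded here sorry-free for the lead: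

* `eq_C_of_comp_X_add_C_eq` — **a polynomial with a non-zero period is constant**:
  `p(X + c) = p(X)`, `c ≠ 0` ⇒ `p = C (p 0)` (all `n·c`, `n ∈ ℕ`, are roots of `p − p(0)`);
* `natDegree_le_one_of_comp_X_add_C_sub_eq_C` — **a polynomial with constant first difference is
  affine**: `p(X + c) − p(X) = κ`, `c ≠ 0` ⇒ `deg p ≤ 1` (apply the first lemma to `p − (κ/c)·X`).

(The rational-function versions follow: for coprime `f = p/q` with `q` monic, `f(X+c) = f(X)` forces
`q(X) ∣ q(X+c)`, hence `q(X+c) = q(X)`, so `q` and then `p` are constant.)  These are generic algebra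
lemmas; they assert nothing about the Theses statement.
-/

set_option linter.dupNamespace false

namespace Summit.Schanuel.Schanuel.Theorems.AclSubsetLogFreeCore.Negative

open Polynomial

variable {K : Type*} [Field K] [CharZero K]

/-- **A polynomial over a field of characteristic zero with a non-zero period is constant.**
[folklore] -/
theorem eq_C_of_comp_X_add_C_eq (p : K[X]) {c : K} (hc : c ≠ 0)
    (h : p.comp (X + C c) = p) : p = C (p.eval 0) := by
  -- every `n • c` is a root of `p - C (p 0)`
  have hstep : ∀ n : ℕ, p.eval (((n : K) + 1) * c) = p.eval ((n : K) * c) := by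
    intro n
    conv_rhs => rw [← h]
    rw [eval_comp, eval_add, eval_X, eval_C]
    congr 1
    ring
  have hroot : ∀ n : ℕ, (p - C (p.eval 0)).IsRoot ((n : K) * c) := by
    intro n
    induction n with
    | zero => simp
    | succ n ih =>
      rw [IsRoot, eval_sub, eval_C] at ih ⊢
      push_cast
      rw [hstep n]
      exact ih
  have hinf : Set.Infinite {x | (p - C (p.eval 0)).IsRoot x} := by
    apply Set.infinite_of_injective_forall_mem (f := fun n : ℕ => (n : K) * c)
    · intro a b hab
      have hab' : (a : K) = b := mul_right_cancel₀ hc hab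
      exact_mod_cast hab'
    · exact hroot
  exact sub_eq_zero.1 (Polynomial.eq_zero_of_infinite_isRoot _ hinf)

/-- **A polynomial over a field of characteristic zero whose first difference at a non-zero step is
constant has degree at most one.** [folklore] -/
theorem natDegree_le_one_of_comp_X_add_C_sub_eq_C (p : K[X]) {c : K} (hc : c ≠ 0) {κ : K}
    (h : p.comp (X + C c) - p = C κ) : p.natDegree ≤ 1 := by
  have hp' : p.comp (X + C c) = p + C κ := by rw [← h]; ring
  set r : K[X] := p - C (κ / c) * X with hr
  have hrper : r.comp (X + C c) = r := by
    rw [hr, sub_comp, mul_comp, C_comp, X_comp, hp', mul_add, ← C_mul, div_mul_cancel₀ κ hc]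
    ring
  have hrC := eq_C_of_comp_X_add_C_eq r hc hrper
  have hp : p = C (κ / c) * X + r := by rw [hr]; ring
  rw [hp, hrC]
  exact natDegree_linear_le

end Summit.Schanuel.Schanuel.Theorems.AclSubsetLogFreeCore.Negative
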